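import Summits.MatrixMultiplication.MatrixMultiplication.Theorems.FarEdgeDescentTowerChain
import HarnessLib

/-!
# Far-edge descent, kernel XXX-B1: the legs-ratio dynamics of the full-class crude tower

Route `FarEdgeDescent` (cut of record `closes : FiniteSaturation → AnchoredLogConvexity →
MatrixMultiplication`), special leaf `FiniteSaturation` (stmt-MatrixMultiplication-23739): helper
kernel, THESES-FREE and def-free, first of three files (XXX-B1 ratio, XXX-B2 deviation, XXX-B3
dynamics) that turn the NUMBERS exported by kernel XXX-A (`FarEdgeDescentTowerChain.crudeTowerChain_two
K 7`: natural sequences `r, Q, L`, virtual values `G j s t`, the per-stage virtual readout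
`G (j+1) s t ≤ r_j ^ 7` on sub-tangents of `y ↦ ω(1,y,1)`) into the rate record
`e(x) = ω(1,x,1) − (x+1) = O(x^(−0.4269…))` (XXX-B3), by elementary real analysis only — no
tensor appears in these files.

This file: (§1) seventh-power tangent/secant inequalities, the deviation step of `x ↦ x⁷`, the
map `φ(m) = (1−m)⁷ − (1−2m)⁷` (antitone on `[4/25, 19/100]`), `f = φ/(1+φ)`, the `f`-invariant box
`[43/250, 177/1000]` with multiplier bound `λ(m) = 7(1−m)⁶/(1+φ(m)) ≥ 179/100` on it and
`≥ 1/20` everywhere; (§2) for any chain with the clock-`7` recursions of XXX-A: `Q_j + 2L_j = r_j`,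
the normal form `r_{j+1} = r_j⁷(1+φ(m_j))`, `m_{j+1} = f(m_j)` of the legs ratio `m_j = L_j/r_j`,
the growth `2 r_j ≤ 12^(7^j)` (`log r_j ≤ 3·7^j`), and — for the start `r₀ = 6, Q₀ = L₀ = 2` —
the certified orbit `m₂ = L₂/r₂` (exact 39-digit integers), `m₃, …, m₉` (outward-rounded `10⁻⁶`
intervals) and `m_j ∈ [43/250, 177/1000]` for all `j ≥ 9` (`ratio_mem_box`).

References: Pan 1984 (LNCS 179) §17, Thm. 17.1 (the clock); Lotti–Romani 1983, Thm. 3.1,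
Prop. 4.1; Coppersmith–Winograd 1982.
-/

set_option linter.dupNamespace false

noncomputable section

open scoped BigOperators

namespace Summit.MatrixMultiplication.MatrixMultiplication.Theorems.FarEdgeDescentTowerRatio

open Literature.Computability.AlgebraicComplexity

/-! ## §1 Seventh-power inequalities -/

/-- Tangent bound `x⁷ − y⁷ ≥ 7y⁶(x − y)` (`x, y ≥ 0`). [folklore] -/
theorem seven_mul_pow_six_mul_sub_le (x y : ℝ) (hx : 0 ≤ x) (hy : 0 ≤ y) :
    7 * y ^ 6 * (x - y) ≤ x ^ 7 - y ^ 7 := by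
  have key : x ^ 7 - y ^ 7 - 7 * y ^ 6 * (x - y) = (x - y) ^ 2 *
      (x ^ 5 + 2 * x ^ 4 * y + 3 * x ^ 3 * y ^ 2 + 4 * x ^ 2 * y ^ 3 + 5 * x * y ^ 4 + 6 * y ^ 5) := by
    ring
  have hS : 0 ≤ x ^ 5 + 2 * x ^ 4 * y + 3 * x ^ 3 * y ^ 2 + 4 * x ^ 2 * y ^ 3 + 5 * x * y ^ 4 +
      6 * y ^ 5 := by positivity
  nlinarith [mul_nonneg (sq_nonneg (x - y)) hS, key]

/-- Secant bound `x⁷ − y⁷ ≤ 7x⁶(x − y)` (`x, y ≥ 0`). [folklore] -/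
theorem pow_seven_sub_le_seven_mul_pow_six_mul_sub (x y : ℝ) (hx : 0 ≤ x) (hy : 0 ≤ y) :
    x ^ 7 - y ^ 7 ≤ 7 * x ^ 6 * (x - y) := by
  have key : 7 * x ^ 6 * (x - y) - (x ^ 7 - y ^ 7) = (x - y) ^ 2 *
      (y ^ 5 + 2 * y ^ 4 * x + 3 * y ^ 3 * x ^ 2 + 4 * y ^ 2 * x ^ 3 + 5 * y * x ^ 4 + 6 * x ^ 5) := by
    ring
  have hS : 0 ≤ y ^ 5 + 2 * y ^ 4 * x + 3 * y ^ 3 * x ^ 2 + 4 * y ^ 2 * x ^ 3 + 5 * y * x ^ 4 +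
      6 * x ^ 5 := by positivity
  nlinarith [mul_nonneg (sq_nonneg (x - y)) hS, key]

/-- **Deviation step** (the heart of the rate analysis): for `0 ≤ m`, `0 ≤ θ ≤ 1 − 2m`, `0 ≤ γ`,
`[(θ+γ)⁷ − θ⁷] − [(1−m)⁷ − (1−2m)⁷] ≥ 7(1−m)⁶(γ − m) − 7(1−2m+γ)⁶(1−2m−θ)`
(convexity of `x⁷` at `1 − m`, secant bound for the `θ`-deficit). [folklore] -/
theorem deviation_step (m θ γ : ℝ) (hθ : 0 ≤ θ) (hθρ : θ ≤ 1 - 2 * m) (hγ : 0 ≤ γ) :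
    7 * (1 - m) ^ 6 * (γ - m) - 7 * (1 - 2 * m + γ) ^ 6 * (1 - 2 * m - θ) ≤
      ((θ + γ) ^ 7 - θ ^ 7) - ((1 - m) ^ 7 - (1 - 2 * m) ^ 7) := by
  have hρ : 0 ≤ 1 - 2 * m := le_trans hθ hθρ
  have h1 := pow_seven_sub_le_seven_mul_pow_six_mul_sub (1 - 2 * m + γ) (θ + γ) (by positivity)
    (by positivity)
  have h2 := seven_mul_pow_six_mul_sub_le (1 - 2 * m + γ) (1 - m) (by positivity) (by linarith)
  have h3 : θ ^ 7 ≤ (1 - 2 * m) ^ 7 := pow_le_pow_left₀ hθ hθρ 7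
  nlinarith [h1, h2, h3]

/-- `φ(z) = (1−z)⁷ − (1−2z)⁷` is antitone on `[4/25, 19/100]`. [folklore] -/
theorem phi_antitone {x y : ℝ} (hx : (4 : ℝ) / 25 ≤ x) (hxy : x ≤ y) (hy : y ≤ 19 / 100) :
    (1 - y) ^ 7 - (1 - 2 * y) ^ 7 ≤ (1 - x) ^ 7 - (1 - 2 * x) ^ 7 := by
  have h1 := seven_mul_pow_six_mul_sub_le (1 - x) (1 - y) (by linarith) (by linarith)
  have h2 := pow_seven_sub_le_seven_mul_pow_six_mul_sub (1 - 2 * x) (1 - 2 * y) (by linarith)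
    (by linarith)
  have hb : (81 / 100 : ℝ) ^ 6 ≤ (1 - y) ^ 6 := pow_le_pow_left₀ (by norm_num) (by linarith) 6
  have hc : (1 - 2 * x) ^ 6 ≤ (68 / 100 : ℝ) ^ 6 := pow_le_pow_left₀ (by linarith) (by linarith) 6
  have hδ : 0 ≤ y - x := by linarith
  have h3 : 7 * (81 / 100 : ℝ) ^ 6 * (y - x) ≤ 7 * (1 - y) ^ 6 * (y - x) := by gcongr
  have h4 : 7 * (1 - 2 * x) ^ 6 * (2 * (y - x)) ≤ 7 * (68 / 100 : ℝ) ^ 6 * (2 * (y - x)) := by gcongr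
  nlinarith [h1, h2, h3, h4]

/-- `φ ≥ 0` and `φ ≤ 1` for `0 ≤ m ≤ 1/2`. [folklore] -/
theorem phi_nonneg {m : ℝ} (hm : 0 ≤ m) (hm' : m ≤ 1 / 2) :
    0 ≤ (1 - m) ^ 7 - (1 - 2 * m) ^ 7 := by
  have : (1 - 2 * m) ^ 7 ≤ (1 - m) ^ 7 := pow_le_pow_left₀ (by linarith) (by linarith) 7
  linarith

/-- `φ ≤ 1` for `0 ≤ m ≤ 1/2`. [folklore] -/
theorem phi_le_one {m : ℝ} (hm : 0 ≤ m) (hm' : m ≤ 1 / 2) :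
    (1 - m) ^ 7 - (1 - 2 * m) ^ 7 ≤ 1 := by
  have h1 : (1 - m) ^ 7 ≤ 1 ^ 7 := pow_le_pow_left₀ (by linarith) (by linarith) 7
  have h2 : 0 ≤ (1 - 2 * m) ^ 7 := pow_nonneg (by linarith) 7
  linarith

/-- `x ↦ x/(1+x)` is monotone on `x ≥ 0`. [folklore] -/
theorem div_one_add_mono {x y : ℝ} (hx : 0 ≤ x) (hxy : x ≤ y) : x / (1 + x) ≤ y / (1 + y) := by
  rw [div_le_div_iff₀ (by linarith) (by linarith)]
  nlinarith

/-- **One propagation step of the legs ratio**: if `m ∈ [α, β] ⊆ [4/25, 19/100]` then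
`f(m) = φ(m)/(1+φ(m)) ∈ [f(β), f(α)]`. [folklore] -/
theorem f_mem {α β m : ℝ} (hα : (4 : ℝ) / 25 ≤ α) (hαm : α ≤ m) (hmβ : m ≤ β) (hβ : β ≤ 19 / 100) :
    ((1 - β) ^ 7 - (1 - 2 * β) ^ 7) / (1 + ((1 - β) ^ 7 - (1 - 2 * β) ^ 7)) ≤
        ((1 - m) ^ 7 - (1 - 2 * m) ^ 7) / (1 + ((1 - m) ^ 7 - (1 - 2 * m) ^ 7)) ∧
      ((1 - m) ^ 7 - (1 - 2 * m) ^ 7) / (1 + ((1 - m) ^ 7 - (1 - 2 * m) ^ 7)) ≤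
        ((1 - α) ^ 7 - (1 - 2 * α) ^ 7) / (1 + ((1 - α) ^ 7 - (1 - 2 * α) ^ 7)) :=
  ⟨div_one_add_mono (phi_nonneg (by linarith) (by linarith)) (phi_antitone (by linarith) hmβ hβ),
    div_one_add_mono (phi_nonneg (by linarith) (by linarith)) (phi_antitone hα hαm (by linarith))⟩

/-- **The box** `[43/250, 177/1000]` is invariant under `f`, and on it the multiplier
`λ(m) = 7(1−m)⁶/(1+φ(m))` is at least `179/100`. [folklore] -/
theorem box_invariant {m : ℝ} (h1 : (43 : ℝ) / 250 ≤ m) (h2 : m ≤ 177 / 1000) :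
    (43 : ℝ) / 250 ≤ ((1 - m) ^ 7 - (1 - 2 * m) ^ 7) / (1 + ((1 - m) ^ 7 - (1 - 2 * m) ^ 7)) ∧
      ((1 - m) ^ 7 - (1 - 2 * m) ^ 7) / (1 + ((1 - m) ^ 7 - (1 - 2 * m) ^ 7)) ≤ 177 / 1000 := by
  have h := f_mem (α := 43 / 250) (β := 177 / 1000) (by norm_num) h1 h2 (by norm_num)
  constructor
  · refine le_trans ?_ h.1
    rw [le_div_iff₀ (by norm_num)]
    norm_num
  · refine le_trans h.2 ?_
    rw [div_le_iff₀ (by norm_num)]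
    norm_num

/-- On the box `[43/250, 177/1000]` the multiplier `λ(m) = 7(1−m)⁶/(1+φ(m))` is at least
`179/100`. [folklore] -/
theorem lambda_ge_of_mem_box {m : ℝ} (h1 : (43 : ℝ) / 250 ≤ m) (h2 : m ≤ 177 / 1000) :
    (179 : ℝ) / 100 ≤ 7 * (1 - m) ^ 6 / (1 + ((1 - m) ^ 7 - (1 - 2 * m) ^ 7)) := by
  have hφ := phi_antitone (x := 43 / 250) (y := m) (by norm_num) h1 (by linarith)
  have hnum : 7 * (1 - (177 : ℝ) / 1000) ^ 6 ≤ 7 * (1 - m) ^ 6 := by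
    gcongr 7 * ?_ ^ 6
    linarith
  have hpos : 0 < 1 + ((1 - m) ^ 7 - (1 - 2 * m) ^ 7) := by
    linarith [phi_nonneg (m := m) (by linarith) (by linarith)]
  rw [le_div_iff₀ hpos]
  have hden : (179 : ℝ) / 100 * (1 + ((1 - m) ^ 7 - (1 - 2 * m) ^ 7)) ≤
      179 / 100 * (1 + ((1 - (43 : ℝ) / 250) ^ 7 - (1 - 2 * (43 / 250)) ^ 7)) := by
    gcongr
  refine le_trans hden (le_trans ?_ hnum)
  norm_num

/-- The crude multiplier bound `λ(m) ≥ 1/20` for every `0 ≤ m ≤ 1/2`. [folklore] -/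
theorem lambda_ge_crude {m : ℝ} (hm : 0 ≤ m) (hm' : m ≤ 1 / 2) :
    (1 : ℝ) / 20 ≤ 7 * (1 - m) ^ 6 / (1 + ((1 - m) ^ 7 - (1 - 2 * m) ^ 7)) := by
  have hpos : 0 < 1 + ((1 - m) ^ 7 - (1 - 2 * m) ^ 7) := by linarith [phi_nonneg hm hm']
  rw [le_div_iff₀ hpos]
  have h1 : ((1 : ℝ) / 2) ^ 6 ≤ (1 - m) ^ 6 := pow_le_pow_left₀ (by norm_num) (by linarith) 6
  have h2 := phi_le_one hm hm'
  nlinarith [h1, h2]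


/-! ## §2 The legs ratio `m_j = L_j / r_j`: normal form, early stages, the box for `j ≥ 9` -/

section Chain

variable (r Q L : ℕ → ℕ)

/-- `Q_j + 2 L_j = r_j` along the chain. [folklore] -/
theorem anchor_add_two_mul_legs
    (hL : ∀ j, L (j + 1) = (Q j + L j) ^ 7 - Q j ^ 7) (hr : ∀ j, r (j + 1) = r j ^ 7 + L (j + 1))
    (hQ : ∀ j, Q (j + 1) = r j ^ 7 - L (j + 1)) (hall : ∀ j, (Q j + L j) ^ 7 ≤ r j ^ 7)
    (h0 : Q 0 + 2 * L 0 = r 0) : ∀ j, Q j + 2 * L j = r j := by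
  intro j
  induction j with
  | zero => exact h0
  | succ j ih =>
    have h1 := hL j
    have h2 := hr j
    have h3 := hQ j
    have h4 := hall j
    have h5 : Q j ^ 7 ≤ (Q j + L j) ^ 7 := Nat.pow_le_pow_left (Nat.le_add_right _ _) 7
    omega

/-- `r_j ≥ 1` (indeed `r_j ≥ Q_j ≥ 1`). [folklore] -/
theorem one_le_r (hQ1 : ∀ j, 1 ≤ Q j) (hsum : ∀ j, Q j + 2 * L j = r j) (j : ℕ) : 1 ≤ r j := by
  have := hsum j
  have := hQ1 j
  omega

/-- **Normal form of one step** in the ratio `x = L_j/r_j`: `Q_j = r_j(1−2x)`, `Q_j + L_j = r_j(1−x)`,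
`L_{j+1} = r_j⁷ φ(x)`, `r_{j+1} = r_j⁷ (1+φ(x))`, `0 ≤ x ≤ 1/2`. [folklore] -/
theorem step_normalForm
    (hL : ∀ j, L (j + 1) = (Q j + L j) ^ 7 - Q j ^ 7) (hr : ∀ j, r (j + 1) = r j ^ 7 + L (j + 1))
    (hQ1 : ∀ j, 1 ≤ Q j) (hsum : ∀ j, Q j + 2 * L j = r j) (j : ℕ) :
    0 < (r j : ℝ) ∧ 0 ≤ (L j : ℝ) / r j ∧ (L j : ℝ) / r j ≤ 1 / 2 ∧
      (Q j : ℝ) = r j * (1 - 2 * ((L j : ℝ) / r j)) ∧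
      ((L (j + 1) : ℕ) : ℝ) = (r j : ℝ) ^ 7 *
        ((1 - (L j : ℝ) / r j) ^ 7 - (1 - 2 * ((L j : ℝ) / r j)) ^ 7) ∧
      ((r (j + 1) : ℕ) : ℝ) = (r j : ℝ) ^ 7 *
        (1 + ((1 - (L j : ℝ) / r j) ^ 7 - (1 - 2 * ((L j : ℝ) / r j)) ^ 7)) := by
  have hr1 := one_le_r r Q L hQ1 hsum j
  have hrpos : 0 < (r j : ℝ) := by exact_mod_cast hr1
  have hs : (Q j : ℝ) + 2 * L j = r j := by exact_mod_cast hsum j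
  have hQj : (Q j : ℝ) = r j * (1 - 2 * ((L j : ℝ) / r j)) := by
    field_simp
    linarith
  have hQL : ((Q j + L j : ℕ) : ℝ) = r j * (1 - (L j : ℝ) / r j) := by
    push_cast
    field_simp
    linarith
  have hpow : Q j ^ 7 ≤ (Q j + L j) ^ 7 := Nat.pow_le_pow_left (Nat.le_add_right _ _) 7
  have hL' : ((L (j + 1) : ℕ) : ℝ) = (r j : ℝ) ^ 7 *
      ((1 - (L j : ℝ) / r j) ^ 7 - (1 - 2 * ((L j : ℝ) / r j)) ^ 7) := by
    rw [hL j, Nat.cast_sub hpow, Nat.cast_pow, Nat.cast_pow, hQL, hQj]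
    ring
  refine ⟨hrpos, div_nonneg (Nat.cast_nonneg _) hrpos.le, ?_, hQj, hL', ?_⟩
  · rw [div_le_iff₀ hrpos]
    have : (0 : ℝ) ≤ Q j := Nat.cast_nonneg _
    linarith
  · rw [hr j, Nat.cast_add, Nat.cast_pow, hL']
    ring

/-- The ratio recursion `x_{j+1} = φ(x_j)/(1+φ(x_j))`. [folklore] -/
theorem ratio_succ
    (hL : ∀ j, L (j + 1) = (Q j + L j) ^ 7 - Q j ^ 7) (hr : ∀ j, r (j + 1) = r j ^ 7 + L (j + 1))
    (hQ1 : ∀ j, 1 ≤ Q j) (hsum : ∀ j, Q j + 2 * L j = r j) (j : ℕ) :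
    (L (j + 1) : ℝ) / r (j + 1) =
      ((1 - (L j : ℝ) / r j) ^ 7 - (1 - 2 * ((L j : ℝ) / r j)) ^ 7) /
        (1 + ((1 - (L j : ℝ) / r j) ^ 7 - (1 - 2 * ((L j : ℝ) / r j)) ^ 7)) := by
  obtain ⟨hrpos, hx0, hx1, -, hL', hr'⟩ := step_normalForm r Q L hL hr hQ1 hsum j
  have hφ := phi_nonneg hx0 hx1
  rw [hL', hr', mul_div_mul_left _ _ (pow_pos hrpos 7).ne']

/-- Growth: `2 r_j ≤ 12^(7^j)` when `r_0 = 6`. [folklore] -/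
theorem two_mul_r_le (hr : ∀ j, r (j + 1) = r j ^ 7 + L (j + 1))
    (hall : ∀ j, (Q j + L j) ^ 7 ≤ r j ^ 7)
    (hL : ∀ j, L (j + 1) = (Q j + L j) ^ 7 - Q j ^ 7) (h0 : r 0 = 6) :
    ∀ j, 2 * r j ≤ 12 ^ 7 ^ j := by
  intro j
  induction j with
  | zero => simp [h0]
  | succ j ih =>
    have h1 : L (j + 1) ≤ r j ^ 7 := by
      rw [hL j]; exact le_trans (Nat.sub_le _ _) (hall j)
    have h2 : 2 * r (j + 1) ≤ 4 * r j ^ 7 := by rw [hr j]; omega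
    have h3 : (2 * r j) ^ 7 ≤ (12 ^ 7 ^ j) ^ 7 := Nat.pow_le_pow_left ih 7
    rw [← pow_mul, ← pow_succ] at h3
    calc 2 * r (j + 1) ≤ 4 * r j ^ 7 := h2
      _ ≤ 2 ^ 7 * r j ^ 7 := by omega
      _ = (2 * r j) ^ 7 := by ring
      _ ≤ 12 ^ 7 ^ (j + 1) := h3

/-- `log r_j ≤ 3·7^j` when `r_0 = 6`. [folklore] -/
theorem log_r_le (hr : ∀ j, r (j + 1) = r j ^ 7 + L (j + 1))
    (hall : ∀ j, (Q j + L j) ^ 7 ≤ r j ^ 7)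
    (hL : ∀ j, L (j + 1) = (Q j + L j) ^ 7 - Q j ^ 7) (h0 : r 0 = 6) (hQ1 : ∀ j, 1 ≤ Q j)
    (hsum : ∀ j, Q j + 2 * L j = r j) (j : ℕ) :
    Real.log (r j) ≤ 3 * 7 ^ j := by
  have h := two_mul_r_le r Q L hr hall hL h0 j
  have hr1 := one_le_r r Q L hQ1 hsum j
  have hrpos : 0 < (r j : ℝ) := by exact_mod_cast hr1
  have h' : (r j : ℝ) ≤ (12 : ℝ) ^ 7 ^ j := by
    have : ((2 * r j : ℕ) : ℝ) ≤ ((12 ^ 7 ^ j : ℕ) : ℝ) := by exact_mod_cast h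
    push_cast at this
    have h0' : (0 : ℝ) ≤ r j := hrpos.le
    linarith
  have hlog12 : Real.log 12 ≤ 3 := by
    rw [Real.log_le_iff_le_exp (by norm_num)]
    have h1 := Real.exp_one_gt_d9
    have h3 : Real.exp 3 = Real.exp 1 ^ 3 := by rw [← Real.exp_nat_mul]; norm_num
    rw [h3]
    have h4 : (2.7182818283 : ℝ) ^ 3 ≤ Real.exp 1 ^ 3 := pow_le_pow_left₀ (by norm_num) h1.le 3
    have h5 : (12 : ℝ) ≤ (2.7182818283 : ℝ) ^ 3 := by norm_num
    linarith
  calc Real.log (r j) ≤ Real.log ((12 : ℝ) ^ 7 ^ j) := Real.log_le_log hrpos h'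
    _ = 7 ^ j * Real.log 12 := by rw [Real.log_pow]; push_cast; ring
    _ ≤ 7 ^ j * 3 := by gcongr
    _ = 3 * 7 ^ j := by ring

/-- One certified propagation step of the ratio interval. [folklore] -/
theorem ratio_step_mem {α β α' β' x x' : ℝ} (hα : (4 : ℝ) / 25 ≤ α) (hβ : β ≤ 19 / 100)
    (hx : α ≤ x ∧ x ≤ β)
    (hx' : x' = ((1 - x) ^ 7 - (1 - 2 * x) ^ 7) / (1 + ((1 - x) ^ 7 - (1 - 2 * x) ^ 7)))
    (h1 : α' ≤ ((1 - β) ^ 7 - (1 - 2 * β) ^ 7) / (1 + ((1 - β) ^ 7 - (1 - 2 * β) ^ 7)))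
    (h2 : ((1 - α) ^ 7 - (1 - 2 * α) ^ 7) / (1 + ((1 - α) ^ 7 - (1 - 2 * α) ^ 7)) ≤ β') :
    α' ≤ x' ∧ x' ≤ β' := by
  have h := f_mem hα hx.1 hx.2 hβ
  rw [hx']
  exact ⟨h1.trans h.1, h.2.trans h2⟩

/-- **The box.**  For the chain started at `r₀ = 6, Q₀ = 2, L₀ = 2` (clock `7`): the exact values
`m₂ = L₂/r₂ ∈ [0.1873, 0.187301]`, the certified propagation `m₃, …, m₉` (outward-rounded `10⁻⁶`
intervals), and `m_j ∈ [43/250, 177/1000]` for every `j ≥ 9`. [folklore] -/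
theorem ratio_mem_box
    (hL : ∀ j, L (j + 1) = (Q j + L j) ^ 7 - Q j ^ 7) (hr : ∀ j, r (j + 1) = r j ^ 7 + L (j + 1))
    (hQ : ∀ j, Q (j + 1) = r j ^ 7 - L (j + 1)) (hQ1 : ∀ j, 1 ≤ Q j)
    (hall : ∀ j, (Q j + L j) ^ 7 ≤ r j ^ 7) (h0r : r 0 = 6) (h0Q : Q 0 = 2) (h0L : L 0 = 2) :
    ∀ j, 9 ≤ j → (43 : ℝ) / 250 ≤ (L j : ℝ) / r j ∧ (L j : ℝ) / r j ≤ 177 / 1000 := by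
  have h0 : Q 0 + 2 * L 0 = r 0 := by rw [h0Q, h0L, h0r]
  have hsum := anchor_add_two_mul_legs r Q L hL hr hQ hall h0
  have hrec := ratio_succ r Q L hL hr hQ1 hsum
  -- exact early stages
  have hL1 : L 1 = 16256 := by rw [hL 0, h0Q, h0L]; norm_num
  have hr1 : r 1 = 296192 := by rw [hr 0, h0r, hL1]; norm_num
  have hQ1' : Q 1 = 263680 := by rw [hQ 0, h0r, hL1]; norm_num
  have hL2 : L 2 = 46091794531484846221836184574436048896 := by
    rw [hL 1, hQ1', hL1]; norm_num
  have hr2 : r 2 = 246084092155603549010846855071315001344 := by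
    rw [hr 1, hr1, hL2]; norm_num
  have I2 : (187300 : ℝ) / 1000000 ≤ (L 2 : ℝ) / r 2 ∧ (L 2 : ℝ) / r 2 ≤ 187301 / 1000000 := by
    rw [hL2, hr2]
    push_cast
    constructor
    · rw [le_div_iff₀ (by norm_num)]; norm_num
    · rw [div_le_iff₀ (by norm_num)]; norm_num
  have I3 := ratio_step_mem (α' := 164395 / 1000000) (β' := 164397 / 1000000) (by norm_num)
    (by norm_num) I2 (hrec 2)
    (by rw [le_div_iff₀ (by norm_num)]; norm_num) (by rw [div_le_iff₀ (by norm_num)]; norm_num)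
  have I4 := ratio_step_mem (α' := 182386 / 1000000) (β' := 182388 / 1000000) (by norm_num)
    (by norm_num) I3 (hrec 3)
    (by rw [le_div_iff₀ (by norm_num)]; norm_num) (by rw [div_le_iff₀ (by norm_num)]; norm_num)
  have I5 := ratio_step_mem (α' := 168408 / 1000000) (β' := 168411 / 1000000) (by norm_num)
    (by norm_num) I4 (hrec 4)
    (by rw [le_div_iff₀ (by norm_num)]; norm_num) (by rw [div_le_iff₀ (by norm_num)]; norm_num)
  have I6 := ratio_step_mem (α' := 179386 / 1000000) (β' := 179390 / 1000000) (by norm_num)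
    (by norm_num) I5 (hrec 5)
    (by rw [le_div_iff₀ (by norm_num)]; norm_num) (by rw [div_le_iff₀ (by norm_num)]; norm_num)
  have I7 := ratio_step_mem (α' := 170823 / 1000000) (β' := 170827 / 1000000) (by norm_num)
    (by norm_num) I6 (hrec 6)
    (by rw [le_div_iff₀ (by norm_num)]; norm_num) (by rw [div_le_iff₀ (by norm_num)]; norm_num)
  have I8 := ratio_step_mem (α' := 177544 / 1000000) (β' := 177548 / 1000000) (by norm_num)
    (by norm_num) I7 (hrec 7)
    (by rw [le_div_iff₀ (by norm_num)]; norm_num) (by rw [div_le_iff₀ (by norm_num)]; norm_num)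
  have I9 := ratio_step_mem (α' := 172292 / 1000000) (β' := 172296 / 1000000) (by norm_num)
    (by norm_num) I8 (hrec 8)
    (by rw [le_div_iff₀ (by norm_num)]; norm_num) (by rw [div_le_iff₀ (by norm_num)]; norm_num)
  intro j hj
  induction j with
  | zero => omega
  | succ j ih =>
    rcases Nat.lt_or_ge j 9 with hj9 | hj9
    · have : j = 8 := by omega
      subst this
      exact ⟨by linarith [I9.1], by linarith [I9.2]⟩
    · have hb := box_invariant (ih hj9).1 (ih hj9).2
      rw [hrec j]
      exact hb

end Chain



end Summit.MatrixMultiplication.MatrixMultiplication.Theorems.FarEdgeDescentTowerRatio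

end
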